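import Mathlib
import Literature.Computability.QuantumComplexity.PauliParseval

/-!
# Route SymplecticPurity · item SymplecticPurityBound — purity of a cut as Pauli spectral mass,
and Pauli character sums (helper file 2/5)

For a vector `φ` on a register `ι → Bool` and a wire set `W`, the purity `Tr ρ_W²` of the reduced
state on `W`, written as the four-fold agreement sum
`Σ [x₁ =_{Wᶜ} x₂] [x₂ =_W x₃] [x₃ =_{Wᶜ} x₄] [x₄ =_W x₁] φ(x₁) φ̄(x₂) φ(x₃) φ̄(x₄)`,
equals `2^{-|W|} Σ_{S ∈ 𝒫_W} |⟨φ|σ_S|φ⟩|²` (Kempe–Regev–Unger–de Wolf, Quantum Inf. Comput. 10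
(2010), §2–3: Parseval on the block together with Observation 3). We prove it directly from the
four-label completeness kernel of the strings supported in `W` (the `if`s carry an arbitrary
`Decidable` instance so that the identity rewrites the route statement verbatim), and record the two
extreme cuts (`W = ∅`, `W = univ`), where the sum is `‖φ‖⁴`.

The second part evaluates the **character sums of the commutation sign**
`sgn(Q,R) = ∏ᵢ sign(Qᵢ,Rᵢ)`: over the strings supported in `A`
(`Σ_{Q ∈ 𝒫_A} sgn(Q,R) = 4^{|A|} [R|_A = I]`, Observation 4 of Kempe et al. on every wire) and over
the diagonal strings `I^n ⊗ {I,Z}^m` (`= 2^m [R|_anc ∈ {I,Z}^m]`).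
-/

noncomputable section

set_option linter.dupNamespace false -- D-0017: single-problem summit ⇒ `QuantumAdvantage.QuantumAdvantage` by design

open Matrix Finset
open Literature.Computability.QuantumComplexity

namespace Summit.QuantumAdvantage.QuantumAdvantage.Theorems.SymplecticPurity

variable {ι : Type*} [Fintype ι] [DecidableEq ι]

/-- **Four-label completeness kernel of the strings on `W`**:
`Σ_{S ∈ 𝒫_W} S_{xy} conj(S_{x'y'}) = 2^{|W|}` if `x, x'` and `y, y'` agree on `W` while `x, y` and
`x', y'` agree off `W`; `0` otherwise. -/
theorem sum_stringsOn_apply_mul_star_apply_eq (W : Finset ι) (x y x' y' : ι → Bool) :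
    ∑ S ∈ stringsOn W, pauliString S x y * star (pauliString S x' y') =
      if (∀ i ∈ W, x i = x' i ∧ y i = y' i) ∧ (∀ i ∉ W, x i = y i ∧ x' i = y' i)
      then (2 : ℂ) ^ W.card else 0 := by
  have hstar : ∀ S : ι → Pauli, star (pauliString S x' y') = pauliString S y' x' := fun S => by
    have := congrFun (congrFun (conjTranspose_pauliString S) y') x'
    rwa [Matrix.conjTranspose_apply] at this
  simp only [hstar]
  simp only [pauliString_eq, tensorAll_apply, ← Finset.prod_mul_distrib, stringsOn]
  rw [← Finset.prod_univ_sum (fun i => if i ∈ W then Finset.univ else {Pauli.I})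
    (fun i Q => Pauli.mat Q (x i) (y i) * Pauli.mat Q (y' i) (x' i))]
  have key : ∀ i, (∑ Q ∈ (if i ∈ W then Finset.univ else {Pauli.I}),
      Pauli.mat Q (x i) (y i) * Pauli.mat Q (y' i) (x' i)) =
      if (i ∈ W → x i = x' i ∧ y i = y' i) ∧ (i ∉ W → x i = y i ∧ x' i = y' i)
      then (if i ∈ W then 2 else 1) else 0 := by
    intro i
    by_cases hi : i ∈ W
    · simp only [hi, if_true, Pauli.sum_mat_mul_mat, true_implies, not_true_eq_false,
        false_implies, and_true]
    · simp only [hi, if_false, Finset.sum_singleton, Pauli.mat_I_apply, false_implies, true_and,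
        not_false_eq_true, true_implies]
      by_cases h1 : x i = y i <;> by_cases h2 : x' i = y' i <;> simp [h1, h2, eq_comm]
  simp only [key]
  rw [Fintype.prod_ite_zero]
  have hprod : (∏ i : ι, (if i ∈ W then (2 : ℂ) else 1)) = 2 ^ W.card := by
    rw [Finset.prod_ite_mem, Finset.univ_inter, Finset.prod_const]
  rw [hprod]
  by_cases h : (∀ i ∈ W, x i = x' i ∧ y i = y' i) ∧ (∀ i ∉ W, x i = y i ∧ x' i = y' i)
  · rw [if_pos h, if_pos (fun i => ⟨fun hi => h.1 i hi, fun hi => h.2 i hi⟩)]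
  · rw [if_neg h, if_neg (fun h' => h ⟨fun i hi => (h' i).1 hi, fun i hi => (h' i).2 hi⟩)]

/-- The expectation `⟨φ|σ_S|φ⟩` as a double sum over labels. -/
theorem star_dotProduct_pauliString_mulVec (φ : (ι → Bool) → ℂ) (S : ι → Pauli) :
    star φ ⬝ᵥ (pauliString S *ᵥ φ) =
      ∑ p : (ι → Bool) × (ι → Bool), star (φ p.1) * (pauliString S p.1 p.2 * φ p.2) := by
  rw [Fintype.sum_prod_type]
  simp only [dotProduct, Matrix.mulVec, Pi.star_apply, Finset.mul_sum]

/-- **Purity of a cut as Pauli spectral mass** (complex form):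
`Σ_{S ∈ 𝒫_W} ⟨φ|σ_S|φ⟩ conj⟨φ|σ_S|φ⟩ = 2^{|W|} · (four-fold agreement sum)`. -/
theorem sum_stringsOn_exp_mul_star_exp (φ : (ι → Bool) → ℂ) (W : Finset ι)
    [D : ∀ x₁ x₂ x₃ x₄ : ι → Bool, Decidable ((∀ i ∉ W, x₁ i = x₂ i) ∧ (∀ i ∈ W, x₂ i = x₃ i) ∧
      (∀ i ∉ W, x₃ i = x₄ i) ∧ (∀ i ∈ W, x₄ i = x₁ i))] :
    ∑ S ∈ stringsOn W, (star φ ⬝ᵥ (pauliString S *ᵥ φ)) * star (star φ ⬝ᵥ (pauliString S *ᵥ φ)) =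
      (2 : ℂ) ^ W.card * ∑ x₁ : ι → Bool, ∑ x₂ : ι → Bool, ∑ x₃ : ι → Bool, ∑ x₄ : ι → Bool,
        (if (∀ i ∉ W, x₁ i = x₂ i) ∧ (∀ i ∈ W, x₂ i = x₃ i) ∧ (∀ i ∉ W, x₃ i = x₄ i) ∧
            (∀ i ∈ W, x₄ i = x₁ i)
         then φ x₁ * star (φ x₂) * φ x₃ * star (φ x₄) else 0) := by
  -- Step 1: each term as a double sum over pairs of label pairs
  have h1 : ∀ S : ι → Pauli,
      (star φ ⬝ᵥ (pauliString S *ᵥ φ)) * star (star φ ⬝ᵥ (pauliString S *ᵥ φ)) =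
        ∑ p : (ι → Bool) × (ι → Bool), ∑ q : (ι → Bool) × (ι → Bool),
          (star (φ p.1) * φ p.2 * φ q.1 * star (φ q.2)) *
            (pauliString S p.1 p.2 * star (pauliString S q.1 q.2)) := by
    intro S
    rw [star_dotProduct_pauliString_mulVec, star_sum, Finset.sum_mul_sum]
    refine Finset.sum_congr rfl fun p _ => Finset.sum_congr rfl fun q _ => ?_
    simp only [star_mul', star_star]
    ring
  simp only [h1]
  -- Step 2: move the sum over strings inside and evaluate the kernel
  rw [Finset.sum_comm]
  simp only [Finset.sum_comm (s := stringsOn W), ← Finset.mul_sum,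
    sum_stringsOn_apply_mul_star_apply_eq, mul_ite, mul_zero]
  -- Step 3: relabel `(x₁, x₂, x₃, x₄) = (p.2, p.1, q.1, q.2)`
  rw [Finset.mul_sum, Fintype.sum_prod_type, Finset.sum_comm]
  refine Finset.sum_congr rfl fun x₁ _ => ?_
  rw [Finset.mul_sum]
  refine Finset.sum_congr rfl fun x₂ _ => ?_
  rw [Fintype.sum_prod_type, Finset.mul_sum]
  refine Finset.sum_congr rfl fun x₃ _ => ?_
  rw [Finset.mul_sum]
  refine Finset.sum_congr rfl fun x₄ _ => ?_
  by_cases h : (∀ i ∉ W, x₁ i = x₂ i) ∧ (∀ i ∈ W, x₂ i = x₃ i) ∧ (∀ i ∉ W, x₃ i = x₄ i) ∧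
      (∀ i ∈ W, x₄ i = x₁ i)
  · rw [if_pos h, if_pos]
    · ring
    · exact ⟨fun i hi => ⟨h.2.1 i hi, (h.2.2.2 i hi).symm⟩,
        fun i hi => ⟨(h.1 i hi).symm, h.2.2.1 i hi⟩⟩
  · rw [if_neg h, if_neg, mul_zero]
    intro h'
    exact h ⟨fun i hi => ((h'.2 i hi).1).symm, fun i hi => (h'.1 i hi).1,
      fun i hi => (h'.2 i hi).2, fun i hi => ((h'.1 i hi).2).symm⟩

/-- **Purity of a cut as Pauli spectral mass**: the four-fold agreement sum of `φ` across the cut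
`W | Wᶜ` is the real number `2^{-|W|} Σ_{S ∈ 𝒫_W} |⟨φ|σ_S|φ⟩|²`. -/
theorem fourFold_eq_spectralMass (φ : (ι → Bool) → ℂ) (W : Finset ι)
    [D : ∀ x₁ x₂ x₃ x₄ : ι → Bool, Decidable ((∀ i ∉ W, x₁ i = x₂ i) ∧ (∀ i ∈ W, x₂ i = x₃ i) ∧
      (∀ i ∉ W, x₃ i = x₄ i) ∧ (∀ i ∈ W, x₄ i = x₁ i))] :
    (∑ x₁ : ι → Bool, ∑ x₂ : ι → Bool, ∑ x₃ : ι → Bool, ∑ x₄ : ι → Bool,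
        (if (∀ i ∉ W, x₁ i = x₂ i) ∧ (∀ i ∈ W, x₂ i = x₃ i) ∧ (∀ i ∉ W, x₃ i = x₄ i) ∧
            (∀ i ∈ W, x₄ i = x₁ i)
         then φ x₁ * star (φ x₂) * φ x₃ * star (φ x₄) else 0)) =
      ((((2 : ℝ) ^ W.card)⁻¹ * ∑ S ∈ stringsOn W, ‖star φ ⬝ᵥ (pauliString S *ᵥ φ)‖ ^ 2 : ℝ) : ℂ) := by
  have h := sum_stringsOn_exp_mul_star_exp φ W
  have h2 : ((∑ S ∈ stringsOn W, ‖star φ ⬝ᵥ (pauliString S *ᵥ φ)‖ ^ 2 : ℝ) : ℂ) =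
      ∑ S ∈ stringsOn W, (star φ ⬝ᵥ (pauliString S *ᵥ φ)) * star (star φ ⬝ᵥ (pauliString S *ᵥ φ)) := by
    push_cast
    refine Finset.sum_congr rfl fun S _ => ?_
    rw [Complex.star_def, Complex.mul_conj']
  have hpow : ((2 : ℂ) ^ W.card) ≠ 0 := pow_ne_zero _ two_ne_zero
  rw [Complex.ofReal_mul, Complex.ofReal_inv, Complex.ofReal_pow, Complex.ofReal_ofNat, h2, h,
    ← mul_assoc, inv_mul_cancel₀ hpow, one_mul]

/-- `⟨φ|σ_I|φ⟩ = ⟨φ|φ⟩ = Σ |φ x|²`. -/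
theorem star_dotProduct_pauliString_I_mulVec (φ : (ι → Bool) → ℂ) :
    star φ ⬝ᵥ (pauliString (fun _ : ι => Pauli.I) *ᵥ φ) = ((∑ x, ‖φ x‖ ^ 2 : ℝ) : ℂ) := by
  rw [pauliString_const_I, Matrix.one_mulVec]
  push_cast
  simp only [dotProduct, Pi.star_apply]
  refine Finset.sum_congr rfl fun x _ => ?_
  rw [Complex.star_def, Complex.conj_mul']

/-- The four-fold sum at the empty cut is `‖φ‖⁴`. -/
theorem fourFold_empty (φ : (ι → Bool) → ℂ)
    [D : ∀ x₁ x₂ x₃ x₄ : ι → Bool, Decidable ((∀ i ∉ (∅ : Finset ι), x₁ i = x₂ i) ∧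
      (∀ i ∈ (∅ : Finset ι), x₂ i = x₃ i) ∧ (∀ i ∉ (∅ : Finset ι), x₃ i = x₄ i) ∧
      (∀ i ∈ (∅ : Finset ι), x₄ i = x₁ i))] :
    (∑ x₁ : ι → Bool, ∑ x₂ : ι → Bool, ∑ x₃ : ι → Bool, ∑ x₄ : ι → Bool,
        (if (∀ i ∉ (∅ : Finset ι), x₁ i = x₂ i) ∧ (∀ i ∈ (∅ : Finset ι), x₂ i = x₃ i) ∧
            (∀ i ∉ (∅ : Finset ι), x₃ i = x₄ i) ∧ (∀ i ∈ (∅ : Finset ι), x₄ i = x₁ i)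
         then φ x₁ * star (φ x₂) * φ x₃ * star (φ x₄) else 0)) =
      (((∑ x, ‖φ x‖ ^ 2) ^ 2 : ℝ) : ℂ) := by
  rw [fourFold_eq_spectralMass, stringsOn_empty, Finset.sum_singleton,
    star_dotProduct_pauliString_I_mulVec, Complex.norm_real, Real.norm_eq_abs, sq_abs,
    Finset.card_empty, pow_zero, inv_one, one_mul]

/-- `⟨φ|σ_S|φ⟩` is the Pauli coefficient `Tr(σ_S |φ⟩⟨φ|)` of the rank-one matrix `|φ⟩⟨φ|`. -/
theorem star_dotProduct_pauliString_mulVec_eq_pauliCoeff (φ : (ι → Bool) → ℂ) (S : ι → Pauli) :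
    star φ ⬝ᵥ (pauliString S *ᵥ φ) = pauliCoeff (vecMulVec φ (star φ)) S := by
  rw [pauliCoeff_eq, Matrix.trace]
  simp only [Matrix.diag_apply, Matrix.mul_apply, vecMulVec_apply, Pi.star_apply, dotProduct,
    Matrix.mulVec, Finset.mul_sum]
  refine Finset.sum_congr rfl fun x _ => Finset.sum_congr rfl fun y _ => ?_
  ring

/-- **Parseval for a vector state**: `Σ_S |⟨φ|σ_S|φ⟩|² = 2^{|ι|} ‖φ‖⁴`. -/
theorem sum_norm_exp_sq (φ : (ι → Bool) → ℂ) :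
    ∑ S : ι → Pauli, ‖star φ ⬝ᵥ (pauliString S *ᵥ φ)‖ ^ 2 =
      (2 : ℝ) ^ Fintype.card ι * (∑ x, ‖φ x‖ ^ 2) ^ 2 := by
  simp only [star_dotProduct_pauliString_mulVec_eq_pauliCoeff, sum_norm_pauliCoeff_sq]
  congr 1
  simp only [vecMulVec_apply, Pi.star_apply, norm_mul, norm_star, mul_pow]
  rw [sq, Finset.sum_mul_sum]

/-- The four-fold sum at the full cut is `‖φ‖⁴`. -/
theorem fourFold_univ (φ : (ι → Bool) → ℂ)
    [D : ∀ x₁ x₂ x₃ x₄ : ι → Bool, Decidable ((∀ i ∉ (Finset.univ : Finset ι), x₁ i = x₂ i) ∧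
      (∀ i ∈ (Finset.univ : Finset ι), x₂ i = x₃ i) ∧
      (∀ i ∉ (Finset.univ : Finset ι), x₃ i = x₄ i) ∧
      (∀ i ∈ (Finset.univ : Finset ι), x₄ i = x₁ i))] :
    (∑ x₁ : ι → Bool, ∑ x₂ : ι → Bool, ∑ x₃ : ι → Bool, ∑ x₄ : ι → Bool,
        (if (∀ i ∉ (Finset.univ : Finset ι), x₁ i = x₂ i) ∧
            (∀ i ∈ (Finset.univ : Finset ι), x₂ i = x₃ i) ∧
            (∀ i ∉ (Finset.univ : Finset ι), x₃ i = x₄ i) ∧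
            (∀ i ∈ (Finset.univ : Finset ι), x₄ i = x₁ i)
         then φ x₁ * star (φ x₂) * φ x₃ * star (φ x₄) else 0)) =
      (((∑ x, ‖φ x‖ ^ 2) ^ 2 : ℝ) : ℂ) := by
  rw [fourFold_eq_spectralMass, stringsOn_univ, sum_norm_exp_sq, Finset.card_univ, ← mul_assoc,
    inv_mul_cancel₀ (pow_ne_zero _ two_ne_zero), one_mul]

/-! ## Character sums of the commutation sign

The finite-group input of the stabilizer counting: orthogonality of the characters
`Q ↦ sgn(Q,R)` on product families of strings. -/

/-- `sign(q, I) = 1`: everything commutes with the identity. -/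
theorem pauli_sign_I_right (q : Pauli) : Pauli.sign q Pauli.I = 1 := by
  cases q <;> simp [Pauli.sign]

/-- `sign(I, q) = 1`. -/
theorem pauli_sign_I_left (q : Pauli) : Pauli.sign Pauli.I q = 1 := by
  cases q <;> simp [Pauli.sign]

/-- Signs against the diagonal letters: `Σ_{q ∈ {I,Z}} sign(p,q) = 2 [p ∈ {I,Z}]`. -/
theorem sum_pair_IZ_sign (p : Pauli) :
    ∑ q ∈ ({Pauli.I, Pauli.Z} : Finset Pauli), Pauli.sign p q =
      if p = Pauli.I ∨ p = Pauli.Z then 2 else 0 := by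
  rw [Finset.sum_pair (by decide)]
  cases p <;> simp [Pauli.sign] <;> norm_num

/-- **Character sum over the strings on a wire set** (Observation 4 of Kempe et al. on every wire
of `A`): `Σ_{Q ∈ 𝒫_A} sgn(Q,R) = 4^{|A|}` if `R` is the identity on `A`, and `0` otherwise. -/
theorem sum_stringsOn_prod_sign (A : Finset ι) (R : ι → Pauli) :
    ∑ Q ∈ stringsOn A, ∏ i, Pauli.sign (Q i) (R i) =
      if ∀ i ∈ A, R i = Pauli.I then (4 : ℂ) ^ A.card else 0 := by
  rw [stringsOn, ← Finset.prod_univ_sum (fun i => if i ∈ A then Finset.univ else {Pauli.I})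
    (fun i q => Pauli.sign q (R i))]
  have key : ∀ i, (∑ q ∈ (if i ∈ A then Finset.univ else {Pauli.I}), Pauli.sign q (R i)) =
      if (i ∈ A → R i = Pauli.I) then (if i ∈ A then 4 else 1) else 0 := by
    intro i
    by_cases hi : i ∈ A
    · simp only [hi, if_true, Pauli.sum_sign, true_implies]
    · simp [hi, pauli_sign_I_left]
  simp only [key]
  rw [Fintype.prod_ite_zero]
  have hprod : (∏ i : ι, (if i ∈ A then (4 : ℂ) else 1)) = 4 ^ A.card := by
    rw [Finset.prod_ite_mem, Finset.univ_inter, Finset.prod_const]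
  rw [hprod]

/-- **Character sum over the diagonal strings** `I^n ⊗ {I,Z}^m`:
`Σ_{z} sgn(T,z) = 2^m` if `T` is diagonal (`I` or `Z`) on the last `m` wires, `0` otherwise. -/
theorem sum_piFinset_IZ_prod_sign (n m : ℕ) (T : Fin (n + m) → Pauli) :
    ∑ R ∈ Fintype.piFinset (fun _ : Fin m => ({Pauli.I, Pauli.Z} : Finset Pauli)),
        ∏ i, Pauli.sign (T i) (Fin.append (fun _ : Fin n => Pauli.I) R i) =
      if ∀ j : Fin m, T (Fin.natAdd n j) = Pauli.I ∨ T (Fin.natAdd n j) = Pauli.Z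
      then (2 : ℂ) ^ m else 0 := by
  have h1 : ∀ R : Fin m → Pauli,
      ∏ i, Pauli.sign (T i) (Fin.append (fun _ : Fin n => Pauli.I) R i) =
        ∏ j, Pauli.sign (T (Fin.natAdd n j)) (R j) := by
    intro R
    rw [Fin.prod_univ_add]
    simp only [Fin.append_left, Fin.append_right, pauli_sign_I_right, Finset.prod_const_one,
      one_mul]
  simp only [h1]
  rw [Finset.sum_prod_piFinset]
  simp only [sum_pair_IZ_sign]
  rw [Fintype.prod_ite_zero, Finset.prod_const, Finset.card_univ, Fintype.card_fin]
  by_cases h : ∀ j : Fin m, T (Fin.natAdd n j) = Pauli.I ∨ T (Fin.natAdd n j) = Pauli.Z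
  · rw [if_pos h, if_pos h]
  · rw [if_neg h, if_neg h]

end Summit.QuantumAdvantage.QuantumAdvantage.Theorems.SymplecticPurity

end
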